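import Summits.QuantumFields.BalabanUV.Beta.CoclosedCovectorLinearRows

/-!
# `BalabanUV.Beta.CoclosedCovectorLinearRowsNear` — binder row D1 ∕ (C1) OWNER an2 (gen 60), PART 2 of `CoclosedCovectorLinearRows` (an2 g60 INTENT-1 ∕ INTENT-2,
# journal [AN2-G60-ONLINE] ∕ [AN2-G60-INTENT-2]): **SUPPORTS ON THE `Near` BOXES, AND THE CO-CLOSED PAIRING OF THE LINEAR ROWS FOR BOUNDED (E.G. PERIODIC) COVECTORS,
# FINE BOND BY FINE BOND, WITH NO SUMMABILITY DISPLAYED** — the currency of the displayed row (K1) of `FP/StepRecursionFeedNestedNamedB` (a PERIODIC `λ′`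
# paired over `ℤ^d` against `symLinKerAt ρ_c Lc μ y (u)`): `⟨ψ, symLinKerAt ρ L · · u⟩ = ⟨ψ, linKerAt ρ′ L · · u⟩ = (L^d)⁻¹·⟨ψ, straightCount L · · u⟩` and
# `⟨ψ, linCountAt ρ L · · u⟩ = ⟨ψ, straightCount L · · u⟩ = L^d·⟨ψ, symLinKerAt ρ′ L · · u⟩` for every BOUNDED `ψ` with `codiff₁ ψ = 0`, roots in the block, `0 < L`

HONEST FRAMING (cell charter, verbatim): «discharging `BetaPertH` makes Bałaban's UV stability UNCONDITIONAL — a real constructive-QFT result; it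
is NOT the continuum limit and NOT the Clay problem.»  THIS MODULE DISCHARGES NOTHING of `BetaPertH` ∕ row D1: [folklore] support bookkeeping (`LettersIn` ∕
`Hull` ∕ `Near` of `AveragingHessianKernels`, BY NAME) + part 1's summation by parts.  0 `def`, 0 `def … : Prop`, 0 sorry, nothing cited; no kernel of
Bałaban's, no table VALUE, no estimate.  NOT (C1), NOT K1, NOT D1, NEVER «G-an2-4 closed», NOT BetaPertH, NOT continuum, NOT Clay.

WHY.  Part 1 §4 (`lip1_symLinAvgAt_of_bounded`, `lip1_linAvgAt_of_bounded`) pairs a BOUNDED co-closed covector with the rows under two DISPLAYED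
summabilities (the block potential, the straight pairing).  For the rows the END wrapper displays — the indicator rows of ONE fine bond `u` — both are
finite-support facts: the block potentials `SymLamAt ρ (δ1 u) L` ∕ `LamAt ρ (δ1 u) L` (root in the block) and the straight counts `straightCount L · y u`
vanish unless `u` is based in the support box `Near L y` (§1), and for fixed `u.2` those `y` lie in an explicit finite box (§2).  §3 is part 1 §3 for
bounded covectors: the mechanism (ii) sentence of RULING R-D1-g59-3 (Engine C `prestab/k1/K1.md` §6) in (K1)'s own currency, including the scalar `L^d`
(`= 81` at `(d, L) = (4, 3)`: K1.md's `α = −1` vs `−81`); §4 is mechanism (iii)'s first half — the `Λ′`-covector `⟨E″(1) h, ℋ_N(·; l, y)⟩` of ANY fine field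
with summable Hessian image is coarse co-closed (so §3 applies to it once it is bounded).  NOT HERE: the torus periodisation `perF`, mechanism (i), the
second half of (iii) (the block-mean dressing is a fine gradient), and (K1) itself — the road's ∕ the (C1) discharger's.

WHAT (all [folklore]):
* §1 `lip1_const_mul_right` (unconditional), `sum_eq_zero_of_lettersIn_real`, **`straightCount_eq_zero_of_not_near`**, `symAxial_indicator_eq_zero`,
  `near_of_hull_block`, **`SymLamAt_indicator_eq_zero_of_not_near`**, **`LamAt_indicator_eq_zero_of_not_near`**.
* §2 `mem_piFinset_of_near` (`Near L y x ⟹ y ∈ Π_i Icc (x_i ∕ L − 1) (x_i ∕ L)`), `summable_of_near`, `summable_SymLamAt_indicator`, `summable_LamAt_indicator`,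
  `summable_pairing_straightCount`.
* §3 **`lip1_symLinKerAt_of_bounded`**, **`lip1_linCountAt_of_bounded`**, `lip1_linKerAt_of_bounded`, `lip1_symLinKerAt_eq_lip1_linKerAt_of_bounded`,
  **`lip1_linCountAt_eq_pow_mul_lip1_symLinKerAt_of_bounded`**.
* §4 mechanism (iii), first half: `summable_curvAdj`, **`codiff₁_lip1_curvAdj_Hcol`** (the covector `(l, y) ↦ ⟨curvAdj G, ℋ_N(·; l, y)⟩` — `λ′` up to sign for
  `G = curv h` — is coarse CO-CLOSED for every 2-form `G` with summable components; the summable twin of the cell's `codiff₁_lip1_Hcol`).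

HONEST DEPENDENCY (verbatim): «continuum YM on T⁴ ⇐ BetaPertH ∧ nine spine estimates (0/9 proved); BetaPertH ⇐ (D1) ∧ (D4) ∧ CAP+tail;
G-an2-4 gates asym, D1 and NE2/3/4.»  ABSOLUTE RULE (cell, verbatim): «No internally-minted statement may enter as a cited fact. Every
hypothesis is either kernel-proved in this package or a verbatim quotation of a PUBLISHED theorem with page reference.»
Unit `b2b-balaban-beta-an2` gen 60 (row-D1 owner), 2026-08-25; `bears_on: R4-O/T1|T1a` (moves no node counter).  No existing file touched.
-/

noncomputable section

namespace Summit.QuantumFields.BalabanUV.Beta.CoclosedCovectorLinearRowsNear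

open Finset
open scoped BigOperators Nat
open Literature.MathematicalPhysics.QuantumFieldTheory.Balaban1983to89.Beta
open AffineAveraging (Form0 Form1 Site unitVec dz codiff₁ box toSite contourSum)
open AveragingContoursRooted (linAvgAt LamAt)
open AveragingHessianKernels (Bond δ1 straightCount)
open AveragingHessianKernelsRooted (linCountAt linKerAt)
open TransportedContourVariables (mapForm mapForm_apply)
open KKTFluctuationEnergy (lip1)
open Summit.QuantumFields.BalabanUV.Beta.SymmetrisedAxialPotential (symLinAvgAt SymLamAt)
open Summit.QuantumFields.BalabanUV.Beta.SymAveragingHessianCounts (symLinCountAt symLinCountAt_real symLinKerAt)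
open Summit.QuantumFields.BalabanUV.Beta.CoclosedCovectorLinearRows (linCountAt_real straightCount_real lip1_symLinAvgAt_of_bounded
  lip1_linAvgAt_of_bounded)

variable {d : ℕ}

/-! ## §1 Supports on the `Near` boxes -/

section Near

open AveragingHessianKernels (Near LettersIn Hull lettersIn_axial sum_eq_zero_of_lettersIn mem_segUp δ1_apply)
open AveragingContours (axial)
open AffineAveraging (unitVec_apply)
open Summit.QuantumFields.BalabanUV.Beta.SymAveragingHessianCounts (axialP lettersIn_axialP axialP_sum_real)
open Summit.QuantumFields.BalabanUV.Beta.SymmetrisedAxialPotential (symAxial)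

/-- [folklore] Constant multiples pull out of the pairing unconditionally (`tsum_mul_left`). -/
theorem lip1_const_mul_right (ψ B : Form1 d ℝ) (c : ℝ) : lip1 ψ (fun μ y => c * B μ y) = c * lip1 ψ B := by
  unfold lip1
  rw [← tsum_mul_left]
  exact tsum_congr fun y => by rw [Finset.mul_sum]; exact Finset.sum_congr rfl fun μ _ => by ring

/-- [folklore] Letters of the REAL indicator form of the fine bond `u` that are based in a region avoiding `u.2` sum to zero. -/
theorem sum_eq_zero_of_lettersIn_real {P : Site d → Prop} {u : Bond d} (hu : ¬ P u.2) {l : List ℝ}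
    (h : LettersIn (mapForm (Int.castAddHom ℝ) (δ1 u)) P l) : l.sum = 0 := by
  refine List.sum_eq_zero fun a ha => ?_
  obtain ⟨κ, x, hx, ha⟩ := h a ha
  have h0 : mapForm (Int.castAddHom ℝ) (δ1 u) κ x = 0 := by
    have hne : (κ, x) ≠ u := fun e => hu (by rw [← e]; exact hx)
    rw [mapForm_apply, δ1_apply, if_neg hne, map_zero]
  rcases ha with ha | ha
  · rw [ha, h0]
  · rw [ha, h0, neg_zero]

/-- [folklore] The straight count of the fine bond `u` at the coarse bond `(μ, y)` vanishes unless `u` is based in the support box `Near L y`. -/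
theorem straightCount_eq_zero_of_not_near {L : ℕ} (μ : Fin d) {y : Site d} {u : Bond d} (h : ¬ Near L y u.2) :
    straightCount L μ y u = 0 := by
  refine Finset.sum_eq_zero fun b hb => sum_eq_zero_of_lettersIn h ?_
  have hb' : ∀ i, b i < L := by simpa [AffineAveraging.box, Fintype.mem_piFinset, Finset.mem_range] using hb
  intro a ha
  obtain ⟨s, hs', rfl⟩ := mem_segUp ha
  refine ⟨μ, _, fun i => ?_, Or.inl rfl⟩
  have hi := hb' i
  simp only [Pi.add_apply, Pi.smul_apply, smul_eq_mul, toSite, unitVec_apply]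
  split_ifs <;> constructor <;> omega

/-- [folklore] The symmetrised comb potential of the real indicator of `u` between two points vanishes unless `u` is based in their hull. -/
theorem symAxial_indicator_eq_zero {u : Bond d} {Y X : Site d} (h : ¬ Hull Y X u.2) :
    symAxial (mapForm (Int.castAddHom ℝ) (δ1 u)) Y X = 0 :=
  Finset.sum_eq_zero fun σ _ => by
    rw [← axialP_sum_real]
    exact sum_eq_zero_of_lettersIn_real h (lettersIn_axialP σ _ Y X)

/-- [folklore] The coordinatewise hull of two points of the block `B(y)` lies in the support box `Near L y`. -/
theorem near_of_hull_block {L : ℕ} {y : Site d} {r b : Fin d → ℕ} (hr : r ∈ box d L) (hb : b ∈ box d L) {x : Site d}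
    (hx : Hull ((L : ℤ) • y + toSite r) ((L : ℤ) • y + toSite b) x) : Near L y x := by
  have hr' : ∀ i, r i < L := by simpa [AffineAveraging.box, Fintype.mem_piFinset, Finset.mem_range] using hr
  have hb' : ∀ i, b i < L := by simpa [AffineAveraging.box, Fintype.mem_piFinset, Finset.mem_range] using hb
  intro i
  obtain ⟨h1, h2⟩ := hx i
  have hri := hr' i
  have hbi := hb' i
  simp only [Pi.add_apply, Pi.smul_apply, smul_eq_mul, toSite] at h1 h2
  rw [min_le_iff] at h1
  rw [le_max_iff] at h2
  constructor <;> omega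

/-- [folklore] The symmetrised block potential of the real indicator of `u` (root in the block) vanishes off the support box. -/
theorem SymLamAt_indicator_eq_zero_of_not_near {L : ℕ} {r : Fin d → ℕ} (hr : r ∈ box d L) {y : Site d} {u : Bond d}
    (h : ¬ Near L y u.2) : SymLamAt (toSite r) (mapForm (Int.castAddHom ℝ) (δ1 u)) L y = 0 :=
  Finset.sum_eq_zero fun _ hb => symAxial_indicator_eq_zero fun hx => h (near_of_hull_block hr hb hx)

/-- [folklore] The comb's block potential of the real indicator of `u` (root in the block) vanishes off the support box. -/
theorem LamAt_indicator_eq_zero_of_not_near {L : ℕ} {r : Fin d → ℕ} (hr : r ∈ box d L) {y : Site d} {u : Bond d}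
    (h : ¬ Near L y u.2) : LamAt (toSite r) (mapForm (Int.castAddHom ℝ) (δ1 u)) L y = 0 :=
  Finset.sum_eq_zero fun _ hb => sum_eq_zero_of_lettersIn_real (fun hx => h (near_of_hull_block hr hb hx)) (lettersIn_axial _ _ _)

/-! ## §2 Finiteness of the `Near` boxes over the coarse point; summabilities -/

/-- [folklore] For a fixed fine point `x` and `0 < L`, the coarse points `y` with `Near L y x` lie in an explicit finite box. -/
theorem mem_piFinset_of_near {L : ℕ} (hL : 0 < L) {x y : Site d} (h : Near L y x) :
    y ∈ Fintype.piFinset fun i => Finset.Icc (x i / (L : ℤ) - 1) (x i / (L : ℤ)) := by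
  rw [Fintype.mem_piFinset]
  intro i
  obtain ⟨h1, h2⟩ := h i
  have hL' : (0 : ℤ) < (L : ℤ) := by exact_mod_cast hL
  rw [Finset.mem_Icc]
  constructor
  · have h3 : x i < (y i + 2) * (L : ℤ) := by nlinarith
    have h4 : x i / (L : ℤ) < y i + 2 := Int.ediv_lt_of_lt_mul hL' h3
    omega
  · exact Int.le_ediv_of_mul_le hL' (by rw [mul_comm]; exact h1)

/-- [folklore] A function of the coarse point that vanishes off the support box of a fixed fine point is summable (`0 < L`). -/
theorem summable_of_near {L : ℕ} (hL : 0 < L) (x : Site d) {g : Site d → ℝ} (hg : ∀ y, ¬ Near L y x → g y = 0) :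
    Summable g :=
  summable_of_ne_finset_zero (s := Fintype.piFinset fun i => Finset.Icc (x i / (L : ℤ) - 1) (x i / (L : ℤ)))
    fun y hy => hg y fun h => hy (mem_piFinset_of_near hL h)

/-- [folklore] The symmetrised block potential of an indicator form is summable over the coarse lattice (finite support). -/
theorem summable_SymLamAt_indicator {L : ℕ} (hL : 0 < L) {r : Fin d → ℕ} (hr : r ∈ box d L) (u : Bond d) :
    Summable (SymLamAt (toSite r) (mapForm (Int.castAddHom ℝ) (δ1 u)) L) :=
  summable_of_near hL u.2 fun _ hy => SymLamAt_indicator_eq_zero_of_not_near hr hy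

/-- [folklore] The comb's block potential of an indicator form is summable over the coarse lattice (finite support). -/
theorem summable_LamAt_indicator {L : ℕ} (hL : 0 < L) {r : Fin d → ℕ} (hr : r ∈ box d L) (u : Bond d) :
    Summable (LamAt (toSite r) (mapForm (Int.castAddHom ℝ) (δ1 u)) L) :=
  summable_of_near hL u.2 fun _ hy => LamAt_indicator_eq_zero_of_not_near hr hy

/-- [folklore] The straight pairing of ANY covector with the indicator rows of a fixed fine bond converges (finite support in the coarse point). -/
theorem summable_pairing_straightCount (ψ : Form1 d ℝ) {L : ℕ} (hL : 0 < L) (u : Bond d) :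
    Summable fun y => ∑ μ, ψ μ y * contourSum L (mapForm (Int.castAddHom ℝ) (δ1 u)) μ y :=
  summable_of_near hL u.2 fun y hy => Finset.sum_eq_zero fun μ _ => by
    rw [← straightCount_real, straightCount_eq_zero_of_not_near μ hy, Int.cast_zero, mul_zero]

/-! ## §3 The rows on a bounded co-closed covector, fine bond by fine bond -/

/-- [folklore] **THE (0.4) MEAN KERNEL ROWS ON A BOUNDED CO-CLOSED COVECTOR** (root in the block, `0 < L`; the currency of (K1), whose `λ′` is periodic):
`⟨ψ, symLinKerAt ρ L · · u⟩ = (L^d)⁻¹·⟨ψ, straightCount L · · u⟩` for every fine bond `u`. -/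
theorem lip1_symLinKerAt_of_bounded {ψ : Form1 d ℝ} {M : ℝ} (hψ : ∀ μ y, |ψ μ y| ≤ M) (hco : codiff₁ ψ = 0) {L : ℕ}
    (hL : 0 < L) {r : Fin d → ℕ} (hr : r ∈ box d L) (u : Bond d) :
    lip1 ψ (fun μ y => symLinKerAt (toSite r) L μ y u) = ((L : ℝ) ^ d)⁻¹ * lip1 ψ (fun μ y => (straightCount L μ y u : ℝ)) := by
  have hfac : (d ! : ℝ) ≠ 0 := by exact_mod_cast Nat.factorial_ne_zero d
  have h : (fun μ y => symLinKerAt (toSite r) L μ y u)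
      = fun μ y => ((d ! : ℝ) * (L : ℝ) ^ d)⁻¹ * (symLinCountAt (toSite r) L μ y u : ℝ) := by
    funext μ y
    rw [symLinKerAt, div_eq_inv_mul]
  have h1 : (fun μ y => (symLinCountAt (toSite r) L μ y u : ℝ))
      = (symLinAvgAt (toSite r) (mapForm (Int.castAddHom ℝ) (δ1 u)) L : Form1 d ℝ) := by
    funext μ y
    exact symLinCountAt_real _ L μ y u
  have h2 : (fun μ y => (straightCount L μ y u : ℝ)) = contourSum L (mapForm (Int.castAddHom ℝ) (δ1 u)) := by
    funext μ y
    exact straightCount_real L μ y u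
  rw [h, lip1_const_mul_right, h1, h2, lip1_symLinAvgAt_of_bounded hψ hco (toSite r) _ L (summable_SymLamAt_indicator hL hr u)
      (summable_pairing_straightCount ψ hL u), ← mul_assoc, mul_inv, mul_assoc ((d ! : ℝ))⁻¹,
    mul_comm (((L : ℝ) ^ d)⁻¹) (d ! : ℝ), ← mul_assoc, inv_mul_cancel₀ hfac, one_mul]

/-- [folklore] **THE ROOTED COUNT ROWS ON A BOUNDED CO-CLOSED COVECTOR**: `⟨ψ, linCountAt ρ L · · u⟩ = ⟨ψ, straightCount L · · u⟩` (root in the block, `0 < L`). -/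
theorem lip1_linCountAt_of_bounded {ψ : Form1 d ℝ} {M : ℝ} (hψ : ∀ μ y, |ψ μ y| ≤ M) (hco : codiff₁ ψ = 0) {L : ℕ}
    (hL : 0 < L) {r : Fin d → ℕ} (hr : r ∈ box d L) (u : Bond d) :
    lip1 ψ (fun μ y => (linCountAt (toSite r) L μ y u : ℝ)) = lip1 ψ (fun μ y => (straightCount L μ y u : ℝ)) := by
  have h1 : (fun μ y => (linCountAt (toSite r) L μ y u : ℝ))
      = (linAvgAt (toSite r) (mapForm (Int.castAddHom ℝ) (δ1 u)) L : Form1 d ℝ) := by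
    funext μ y
    exact linCountAt_real _ L μ y u
  have h2 : (fun μ y => (straightCount L μ y u : ℝ)) = contourSum L (mapForm (Int.castAddHom ℝ) (δ1 u)) := by
    funext μ y
    exact straightCount_real L μ y u
  rw [h1, h2]
  exact lip1_linAvgAt_of_bounded hψ hco (toSite r) _ L (summable_LamAt_indicator hL hr u) (summable_pairing_straightCount ψ hL u)

/-- [folklore] The comb's mean kernel rows on a bounded co-closed covector: `⟨ψ, linKerAt ρ L · · u⟩ = (L^d)⁻¹·⟨ψ, straightCount L · · u⟩`. -/
theorem lip1_linKerAt_of_bounded {ψ : Form1 d ℝ} {M : ℝ} (hψ : ∀ μ y, |ψ μ y| ≤ M) (hco : codiff₁ ψ = 0) {L : ℕ}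
    (hL : 0 < L) {r : Fin d → ℕ} (hr : r ∈ box d L) (u : Bond d) :
    lip1 ψ (fun μ y => linKerAt (toSite r) L μ y u) = ((L : ℝ) ^ d)⁻¹ * lip1 ψ (fun μ y => (straightCount L μ y u : ℝ)) := by
  have h : (fun μ y => linKerAt (toSite r) L μ y u) = fun μ y => ((L : ℝ) ^ d)⁻¹ * (linCountAt (toSite r) L μ y u : ℝ) := by
    funext μ y
    rw [linKerAt, div_eq_inv_mul]
  rw [h, lip1_const_mul_right, lip1_linCountAt_of_bounded hψ hco hL hr u]

/-- [folklore] **THE TWO MEAN KERNELS HAVE THE SAME BOUNDED CO-CLOSED MOMENTS**, at any two roots in the block. -/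
theorem lip1_symLinKerAt_eq_lip1_linKerAt_of_bounded {ψ : Form1 d ℝ} {M : ℝ} (hψ : ∀ μ y, |ψ μ y| ≤ M) (hco : codiff₁ ψ = 0)
    {L : ℕ} (hL : 0 < L) {r r' : Fin d → ℕ} (hr : r ∈ box d L) (hr' : r' ∈ box d L) (u : Bond d) :
    lip1 ψ (fun μ y => symLinKerAt (toSite r) L μ y u) = lip1 ψ (fun μ y => linKerAt (toSite r') L μ y u) := by
  rw [lip1_symLinKerAt_of_bounded hψ hco hL hr, lip1_linKerAt_of_bounded hψ hco hL hr']

/-- [folklore] **THE `L^d` BETWEEN THE TWO DISPLAYED NORMALISATIONS ON A BOUNDED CO-CLOSED COVECTOR** (K1.md: `α = −1` for `linCountAt`, `−81 = −3⁴`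
for `symLinKerAt` at `(d, L) = (4, 3)`): `⟨ψ, linCountAt ρ L · · u⟩ = L^d·⟨ψ, symLinKerAt ρ′ L · · u⟩`. -/
theorem lip1_linCountAt_eq_pow_mul_lip1_symLinKerAt_of_bounded {ψ : Form1 d ℝ} {M : ℝ} (hψ : ∀ μ y, |ψ μ y| ≤ M)
    (hco : codiff₁ ψ = 0) {L : ℕ} (hL : 0 < L) {r r' : Fin d → ℕ} (hr : r ∈ box d L) (hr' : r' ∈ box d L) (u : Bond d) :
    lip1 ψ (fun μ y => (linCountAt (toSite r) L μ y u : ℝ)) = (L : ℝ) ^ d * lip1 ψ (fun μ y => symLinKerAt (toSite r') L μ y u) := by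
  have hLd : (L : ℝ) ^ d ≠ 0 := pow_ne_zero d (Nat.cast_ne_zero.mpr (Nat.pos_iff_ne_zero.mp hL))
  rw [lip1_symLinKerAt_of_bounded hψ hco hL hr', lip1_linCountAt_of_bounded hψ hco hL hr, ← mul_assoc, mul_inv_cancel₀ hLd, one_mul]

end Near


/-! ## §4 Mechanism (iii), first half: the `Λ′`-covector of a fine field with summable Hessian image is COARSE CO-CLOSED -/

section LamCovector

open AffineAveraging (Form2 curv curvAdj)
open KKTFluctuationEnergy (lip2 lip1_curvAdj summable_shift_sub summable_mul_of_bdd')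
open ResolventComposition (Hcol HcolSum Tex cex sum_Tex curv_HcolSum_Tex Hcol_bdd_summable HcolSum_bdd_summable lip1_sum_right')

/-- [folklore] The formal adjoint `curvAdj` of a 2-form with summable components has summable components. -/
theorem summable_curvAdj {D : ℕ} {G : Form2 D ℝ} (hG : ∀ κ l, Summable (G κ l)) (μ : Fin D) : Summable (curvAdj G μ) := by
  have h1 : ∀ l, Summable fun y => G μ l y - G μ l (y - unitVec l) := fun l => (hG μ l).sub (summable_shift_sub (hG μ l) _)
  have h2 : ∀ κ, Summable fun y => G κ μ (y - unitVec κ) - G κ μ y := fun κ => (summable_shift_sub (hG κ μ) _).sub (hG κ μ)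
  refine ((summable_sum fun l (_ : l ∈ Finset.univ) => h1 l).add (summable_sum fun κ (_ : κ ∈ Finset.univ) => h2 κ)).congr
    fun y => ?_
  simp only [curvAdj]

variable {N : ℕ} [NeZero N]

/-- [folklore] **THE `Λ′`-COVECTOR IS COARSE CO-CLOSED** (mechanism (iii) of RULING R-D1-g59-3, first half, on `ℤ^{d+1}`): for every fine 2-form `G` with
summable components — e.g. `G = curv h` for a decaying minimiser column `h`, when `curvAdj G = E″(1) h` and the covector below is the displayed row's
`λ′ = ℋ♭ E″(1) h` up to the sign `ℋ♭ = −wHᵀ` (`KInv_inr_inl_coarse`, `GamΦ_eq_neg_wH`) — the coarse covector `(l, y) ↦ ⟨curvAdj G, ℋ_N(·; l, y)⟩`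
has `codiff₁ = 0`: its codifferential at `y₀` is `⟨curvAdj G, ℋ_N(−d_c δ_{y₀})⟩ = ⟨G, curv ℋ_N(−d_c δ_{y₀})⟩₂ = 0`, minimiser fields of exact coarse
data being FLAT (`ResolventComposition.curv_HcolSum_Tex`).  The finitely-supported-`F` statement is the cell's `codiff₁_lip1_Hcol`; this is its
summable-`curvAdj` twin, the generality a decaying `h` needs. -/
theorem codiff₁_lip1_curvAdj_Hcol {G : Form2 (d + 1) ℝ} (hG : ∀ κ l, Summable (G κ l)) :
    codiff₁ (fun l y => lip1 (curvAdj G) (Hcol (N := N) l y)) = 0 := by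
  obtain ⟨C, _, hbdd, _⟩ := Hcol_bdd_summable (N := N) (d := d)
  funext y₀
  have hs : ∀ t ∈ Tex y₀, ∀ μ, Summable (fun x => curvAdj G μ x *
      (fun t : Fin (d + 1) × Site (d + 1) => Hcol (N := N) t.1 t.2) t μ x) :=
    fun t _ μ => summable_mul_of_bdd' (summable_curvAdj hG μ) (hbdd t.1 t.2 μ)
  have h := lip1_sum_right' (Tex y₀) (cex y₀) (fun t => Hcol (N := N) t.1 t.2) (curvAdj G) hs
  obtain ⟨C', hHb, _, _⟩ := HcolSum_bdd_summable (N := N) (Tex y₀) (cex y₀)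
  have hflat : lip1 (curvAdj G) (HcolSum (N := N) (Tex y₀) (cex y₀)) = 0 := by
    have hc : lip1 (curvAdj G) (HcolSum (N := N) (Tex y₀) (cex y₀)) = lip1 (HcolSum (N := N) (Tex y₀) (cex y₀)) (curvAdj G) :=
      tsum_congr fun x => Finset.sum_congr rfl fun μ _ => mul_comm _ _
    rw [hc, lip1_curvAdj hHb hG, curv_HcolSum_Tex]
    simp only [lip2, Pi.zero_apply, zero_mul, Finset.sum_const_zero, tsum_zero]
  rw [show HcolSum (N := N) (Tex y₀) (cex y₀) = fun μ x => ∑ t ∈ Tex y₀, cex y₀ t * Hcol (N := N) t.1 t.2 μ x from rfl, h,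
    sum_Tex] at hflat
  simpa only [codiff₁, Pi.zero_apply] using hflat

end LamCovector

end Summit.QuantumFields.BalabanUV.Beta.CoclosedCovectorLinearRowsNear

end
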